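import Mathlib.Topology.Algebra.Valued.NormedValued
import Mathlib.NumberTheory.Padics.RingHoms
import Literature.NumberTheory.EllipticCurves.ComplexMultiplicationCoatesWilesReductionIndexProofs
import HarnessLib

/-!
# BirchSwinnertonDyer — rank ≥ 2 observatory: the reduction homomorphism `E(ℚ) →+ Ẽ(𝔽_q)`

HONEST FRAMING: per-curve certified theorems and census instruments; no claim on BSD in rank ≥ 2.

First of three files (`…ReductionHom`, `…KernelAnnihilator`, `…ReductionWitness`) that discharge,
down to kernel arithmetic, the named hypothesis `hlow : 2 ≤ rank_ℤ E(ℚ)` of the observatory's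
per-curve and census theorems (`Rank2ObservatoryRank2Table.lean`, `Rank2ObservatoryRank2Census.lean`,
`Rank2Observatory389a1.lean`) for curves given by an integral model `V : WeierstrassCurve ℤ` with
listed INTEGRAL points. What `Rank2ObservatoryCosetWitness.lean` left "OUTSIDE Lean" — the reduction
homomorphisms `E(ℚ) → Ẽ(𝔽_q)` — is constructed here from the tree's reduction theory over discrete
valuation rings (`Literature.NumberTheory.EllipticCurves.goodReductionHom`,
`eq_zero_of_zsmul_eq_zero_of_goodReductionHom_eq_zero`; Silverman AEC VII.2–VII.3), applied over
`ℤ_q ⊂ ℚ_q` on the pattern of `Literature/NumberTheory/Automorphic/ThorneQInfinityModularRationalPointsProofs.lean`: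

* `reduceMod V q hq : E(ℚ) →+ Ẽ(ZMod q)` for a prime `q ∤ Δ(V)` (no minimality needed: `Δ ∈ ℤ_q^×`):
  `E(ℚ) ≃ (V.baseChange ℚ)(ℚ) → (V.map (ℤ→ℤ_q)).baseChange ℚ_q (ℚ_q) → Ẽ(ℤ_q/qℤ_q) → Ẽ(ZMod q)`;
* `reduceMod_some` : on an integral point `reduceMod V q hq (X, Y) = (X mod q, Y mod q)`;
* `card_nsmul_eq_zero_of_nsmul_eq_zero` : `q ∤ n`, `n • P = 0` ⟹ `#Ẽ(𝔽_q) • P = 0` — AEC VII.3.1(b)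
  in its prime-to-`q` form, which is exactly what the tree proves and all the certificate needs
  (no claim about `q`-primary torsion is made or used).

Sorry-free; axioms `propext`, `Classical.choice`, `Quot.sound` only. Reference: J. H. Silverman,
*The Arithmetic of Elliptic Curves* (2nd ed. 2009), VII.2 and Prop. VII.3.1(b).
-/

-- single-conjunct summit: `Summit.BirchSwinnertonDyer.BirchSwinnertonDyer.…` repeats the name by design
set_option linter.dupNamespace false

namespace Summit.BirchSwinnertonDyer.BirchSwinnertonDyer.Rank2Observatory

open WeierstrassCurve Literature.NumberTheory.EllipticCurves

/-! ### The models of `V` over `ℚ`, `ℚ_q`, `ℤ_q`, `ℤ_q/q`, `ZMod q` and the reduction homomorphism -/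

section Models

variable (V : WeierstrassCurve ℤ) (q : ℕ) [Fact q.Prime]

/-- `q ∤ Δ(V)` makes `Δ` a unit of `ℤ_q`: the integral model has good reduction at `q` in the
sense of `goodReductionHom` (no minimality needed). [cite: SilvermanAEC2009, VII.2 and Prop. VII.3.1(b)] -/
theorem isUnit_Δ_map_padicInt (hq : ¬ (q : ℤ) ∣ V.Δ) :
    IsUnit (V.map (Int.castRingHom ℤ_[q])).Δ := by
  rw [map_Δ, eq_intCast, PadicInt.isUnit_iff]
  refine le_antisymm (PadicInt.norm_le_one _) (not_lt.1 fun hlt => hq ?_)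
  exact (PadicInt.norm_int_lt_one_iff_dvd _).1 hlt

/-- The residue model `(V mod q)` read through `ℤ → ℤ_q → ℤ_q/qℤ_q ≃ ZMod q` is `V.map (ℤ → ZMod q)`
(uniqueness of ring maps out of `ℤ`). [folklore] -/
theorem residue_model_eq :
    (((V.map (Int.castRingHom ℤ_[q])).map (IsLocalRing.residue ℤ_[q])).map
        (PadicInt.residueField (p := q) : IsLocalRing.ResidueField ℤ_[q] →+* ZMod q)) =
      V.map (Int.castRingHom (ZMod q)) := by
  rw [WeierstrassCurve.map_map, WeierstrassCurve.map_map]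
  exact congrArg V.map (RingHom.ext_int _ _)

/-- `V.map (ℤ → ℚ) = V.baseChange ℚ` (uniqueness of ring maps out of `ℤ`). [folklore] -/
theorem rat_model_eq : V.map (Int.castRingHom ℚ) = V.baseChange ℚ :=
  congrArg V.map (RingHom.ext_int _ _)

/-- `V.baseChange ℚ_q = (V.map (ℤ → ℤ_q)).baseChange ℚ_q` (uniqueness of ring maps out of `ℤ`). [folklore] -/
theorem padic_model_eq :
    V.baseChange ℚ_[q] = (V.map (Int.castRingHom ℤ_[q])).baseChange ℚ_[q] := by
  rw [WeierstrassCurve.baseChange, WeierstrassCurve.baseChange, WeierstrassCurve.map_map]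
  exact congrArg V.map (RingHom.ext_int _ _)

/-- The residue model of `V` at `q` read over `ZMod q` as a base change along
`PadicInt.residueField`, for Mathlib's `Affine.Point.map`. [folklore] -/
theorem residue_model_baseChange_eq :
    letI := ((PadicInt.residueField (p := q)).toRingHom).toAlgebra
    ((V.map (Int.castRingHom ℤ_[q])).map (IsLocalRing.residue ℤ_[q])).baseChange (ZMod q) =
      V.map (Int.castRingHom (ZMod q)) := by
  letI := ((PadicInt.residueField (p := q)).toRingHom).toAlgebra
  rw [WeierstrassCurve.baseChange, WeierstrassCurve.map_map, WeierstrassCurve.map_map]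
  exact congrArg V.map (RingHom.ext_int _ _)

open scoped Classical in
/-- The homomorphism of points along `ℤ_q/qℤ_q ≃ ZMod q` (Mathlib's `Affine.Point.map` along the
algebra map of `PadicInt.residueField`, between two `congrEquiv` transports). [folklore] -/
noncomputable def residuePointHom :
    ((V.map (Int.castRingHom ℤ_[q])).map (IsLocalRing.residue ℤ_[q])).toAffine.Point →+
      (V.map (Int.castRingHom (ZMod q))).toAffine.Point :=
  letI := ((PadicInt.residueField (p := q)).toRingHom).toAlgebra
  (Affine.Point.congrEquiv (residue_model_baseChange_eq V q)).toAddMonoidHom.comp <|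
    (Affine.Point.map (W' := (V.map (Int.castRingHom ℤ_[q])).map (IsLocalRing.residue ℤ_[q]))
        (Algebra.ofId (IsLocalRing.ResidueField ℤ_[q]) (ZMod q))).comp
      (Affine.Point.congrEquiv
        (baseChange_self ((V.map (Int.castRingHom ℤ_[q])).map
          (IsLocalRing.residue ℤ_[q]))).symm).toAddMonoidHom

open scoped Classical in
/-- **The reduction homomorphism `E(ℚ) →+ Ẽ(𝔽_q)`** of an integral model `V` at a prime `q ∤ Δ(V)`:
`E(ℚ) ≃ (V.baseChange ℚ)(ℚ) → E(ℚ_q) ≃ (V.map (ℤ→ℤ_q)).baseChange ℚ_q (ℚ_q) → Ẽ(ℤ_q/qℤ_q) → Ẽ(ZMod q)`,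
the middle arrow being the tree's `goodReductionHom` over the valuation ring `ℤ_q` of `ℚ_q`
(Silverman AEC VII.2). [cite: SilvermanAEC2009, VII.2 and Prop. VII.3.1(b)] -/
noncomputable def reduceMod (hq : ¬ (q : ℤ) ∣ V.Δ) :
    (V.map (Int.castRingHom ℚ)).toAffine.Point →+
      (V.map (Int.castRingHom (ZMod q))).toAffine.Point :=
  (residuePointHom V q).comp <|
  (goodReductionHom (V.map (Int.castRingHom ℤ_[q])) (padicInt_valuationIntegers q)
      (isUnit_Δ_map_padicInt V q hq)).comp <|
  (Affine.Point.congrEquiv (padic_model_eq V q)).toAddMonoidHom.comp <|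
  (Affine.Point.baseChange (W' := V) ℚ ℚ_[q]).comp
    (Affine.Point.congrEquiv (rat_model_eq V)).toAddMonoidHom

open scoped Classical in
/-- **`#Ẽ(𝔽_q)` kills every rational point of order prime to `q`** (`q ∤ Δ`): if `n • P = 0` with
`q ∤ n` then `#Ẽ(𝔽_q) • P = 0`. Proof: `Q :=` the image of `P` in `E(ℚ_q)` satisfies `n • (N • Q) = 0`
with `v_q(n) = 1` and `N • Q ↦ N • (Q mod q) = 0` (Lagrange in `Ẽ(𝔽_q)`), so `N • Q = 0` by the tree's
`eq_zero_of_zsmul_eq_zero_of_goodReductionHom_eq_zero` (AEC VII.3.1(b): no non-zero prime-to-`q`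
torsion in the kernel of reduction); pull back along the injections `E(ℚ) ↪ E(ℚ_q)`.
[cite: SilvermanAEC2009, Prop. VII.3.1(b)] -/
theorem card_nsmul_eq_zero_of_nsmul_eq_zero (hq : ¬ (q : ℤ) ∣ V.Δ)
    (P : (V.map (Int.castRingHom ℚ)).toAffine.Point) {n : ℕ} (hn : ¬ q ∣ n) (h : n • P = 0) :
    Nat.card (V.map (Int.castRingHom (ZMod q))).toAffine.Point • P = 0 := by
  set φ₁ := Affine.Point.congrEquiv (rat_model_eq V) with hφ₁
  set φ₂ := Affine.Point.baseChange (W' := V) ℚ ℚ_[q] with hφ₂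
  set φ₃ := Affine.Point.congrEquiv (padic_model_eq V q) with hφ₃
  set N := Nat.card (V.map (Int.castRingHom (ZMod q))).toAffine.Point with hN
  set Q := φ₃ (φ₂ (φ₁ P)) with hQ
  have hcard : Nat.card (((V.map (Int.castRingHom ℤ_[q])).map
      (IsLocalRing.residue ℤ_[q])).toAffine.Point) = N := by
    rw [hN, ← residue_model_eq V q, natCard_point_map_ringEquiv]
  have hred : goodReductionHom _ (padicInt_valuationIntegers q) (isUnit_Δ_map_padicInt V q hq)
      (N • Q) = 0 := by
    rw [map_nsmul, ← hcard]
    exact card_nsmul_eq_zero'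
  have hPQ : n • Q = 0 := by
    rw [hQ, ← map_nsmul, ← map_nsmul, ← map_nsmul, h, map_zero, map_zero, map_zero]
  have hnQ : (n : ℤ) • (N • Q) = 0 := by
    rw [natCast_zsmul, smul_comm, hPQ, nsmul_zero]
  have hv : NormedField.valuation ((n : ℤ) : ℚ_[q]) = 1 := by
    rw [NormedField.valuation_apply, ← NNReal.coe_inj, coe_nnnorm, NNReal.coe_one]
    refine le_antisymm (Padic.norm_int_le_one _) (not_lt.1 fun hlt => hn ?_)
    have hq' : ((q : ℕ) : ℤ) ∣ (n : ℤ) := Padic.norm_intCast_lt_one_iff.1 hlt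
    exact_mod_cast hq'
  have hNQ : N • Q = 0 :=
    eq_zero_of_zsmul_eq_zero_of_goodReductionHom_eq_zero (padicInt_valuationIntegers q)
      (isUnit_Δ_map_padicInt V q hq) hv hnQ hred
  rw [hQ, ← map_nsmul, ← map_nsmul, ← map_nsmul, ← map_zero φ₃, φ₃.apply_eq_iff_eq,
    ← map_zero φ₂] at hNQ
  have h' := Affine.Point.map_injective _ hNQ
  rwa [← map_zero φ₁, φ₁.apply_eq_iff_eq] at h'

/-- Two affine points with equal coordinates are equal. [folklore] -/
private theorem point_some_congr' {F : Type*} [CommRing F] {W : Affine F} {x y x' y' : F}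
    (hx : x = x') (hy : y = y') {h : W.Nonsingular x y} {h' : W.Nonsingular x' y'} :
    Affine.Point.some x y h = .some x' y' h' := by
  subst hx hy
  rfl

/-- Transport of `Point.some` along equal coordinates. [folklore] -/
private theorem some_congr {F : Type*} [CommRing F] {W : Affine F} {x y x' y' : F}
    (hx : x = x') (hy : y = y') (h : W.Nonsingular x y) :
    ∃ h' : W.Nonsingular x' y', Affine.Point.some x y h = .some x' y' h' := by
  subst hx hy
  exact ⟨h, rfl⟩

omit [Fact q.Prime] in
/-- An integral solution of the Weierstrass equation stays a solution in any ring. [folklore] -/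
theorem equation_intCast_of_equation {S : Type*} [CommRing S] {X Y : ℤ}
    (hXY : V.toAffine.Equation X Y) :
    (V.map (Int.castRingHom S)).toAffine.Equation (X : S) (Y : S) := by
  simpa only [eq_intCast] using Affine.Equation.map (Int.castRingHom S) hXY

/-- `q ∤ Δ`: the model over `ZMod q` has non-zero discriminant. [folklore] -/
theorem Δ_zmod_ne_zero (hq : ¬ (q : ℤ) ∣ V.Δ) : (V.map (Int.castRingHom (ZMod q))).Δ ≠ 0 := by
  rw [map_Δ, eq_intCast, Ne, ZMod.intCast_zmod_eq_zero_iff_dvd]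
  exact hq

/-- An integral point gives a nonsingular point of the model over `ZMod q` (`q ∤ Δ`). [folklore] -/
theorem nonsingular_zmod_of_equation (hq : ¬ (q : ℤ) ∣ V.Δ) {X Y : ℤ}
    (hXY : V.toAffine.Equation X Y) :
    (V.map (Int.castRingHom (ZMod q))).toAffine.Nonsingular (X : ZMod q) (Y : ZMod q) :=
  (Affine.equation_iff_nonsingular_of_Δ_ne_zero (Δ_zmod_ne_zero V q hq)).mp
    (equation_intCast_of_equation V hXY)

open scoped Classical in
/-- **The reduction of an integral point is the point with reduced coordinates**:
`reduceMod V q (X, Y) = (X mod q, Y mod q)` (the tree's `reducePoint_some_algebraMap` for the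
`ℤ_q`-integral representative). [cite: SilvermanAEC2009, VII.2] -/
theorem reduceMod_some (hq : ¬ (q : ℤ) ∣ V.Δ) {X Y : ℤ} (hXY : V.toAffine.Equation X Y)
    (h : (V.map (Int.castRingHom ℚ)).toAffine.Nonsingular (X : ℚ) (Y : ℚ)) :
    reduceMod V q hq (.some (X : ℚ) (Y : ℚ) h) =
      .some (X : ZMod q) (Y : ZMod q) (nonsingular_zmod_of_equation V q hq hXY) := by
  letI := ((PadicInt.residueField (p := q)).toRingHom).toAlgebra
  have hns : ((V.map (Int.castRingHom ℤ_[q])).map (IsLocalRing.residue ℤ_[q])).toAffine.Nonsingular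
      (IsLocalRing.residue ℤ_[q] (X : ℤ_[q])) (IsLocalRing.residue ℤ_[q] (Y : ℤ_[q])) := by
    haveI := isElliptic_map_residue (isUnit_Δ_map_padicInt V q hq)
    exact (Affine.equation_iff_nonsingular).mp
      (Affine.Equation.map (IsLocalRing.residue ℤ_[q]) (equation_intCast_of_equation V hXY))
  simp only [reduceMod, residuePointHom, AddMonoidHom.coe_comp, Function.comp_apply,
    AddEquiv.coe_toAddMonoidHom]
  rw [Affine.Point.congrEquiv_some, Affine.Point.map_some, Affine.Point.congrEquiv_some]
  obtain ⟨hP, e⟩ := some_congr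
    (W := ((V.map (Int.castRingHom ℤ_[q])).baseChange ℚ_[q]).toAffine)
    (x := Algebra.ofId ℚ ℚ_[q] (X : ℚ)) (y := Algebra.ofId ℚ ℚ_[q] (Y : ℚ))
    (x' := algebraMap ℤ_[q] ℚ_[q] (X : ℤ_[q])) (y' := algebraMap ℤ_[q] ℚ_[q] (Y : ℤ_[q]))
    (by rw [Algebra.ofId_apply, map_intCast, map_intCast])
    (by rw [Algebra.ofId_apply, map_intCast, map_intCast]) _
  rw [e, goodReductionHom_apply, WeierstrassCurve.reducePoint_some_algebraMap
    (padicInt_valuationIntegers q).hom_inj hP hns, Affine.Point.congrEquiv_some,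
    Affine.Point.map_some, Affine.Point.congrEquiv_some]
  refine point_some_congr' ?_ ?_
  · exact map_intCast ((PadicInt.residueField (p := q) : _ →+* ZMod q).comp
      (IsLocalRing.residue ℤ_[q])) X
  · exact map_intCast ((PadicInt.residueField (p := q) : _ →+* ZMod q).comp
      (IsLocalRing.residue ℤ_[q])) Y

end Models

end Summit.BirchSwinnertonDyer.BirchSwinnertonDyer.Rank2Observatory
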